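import Literature.Computability.Cryptography.LeftoverHashConditional
import HarnessLib

/-!
# The generalized (conditional) Leftover Hash Lemma for UNIVERSAL families

Sequel of `LeftoverHashMinEntropy.lean` (min-entropy sources) and `LeftoverHashConditional.lean`
(side information), which prove the Leftover Hash Lemma for a PAIRWISE INDEPENDENT family
(`IsPairwiseIndep K h S`). The printed lemmas assume less:

> **Dodis–Ostrovsky–Reyzin–Smith 2008, Lemma 2.4 (Generalized Leftover Hash Lemma).** Assume
> `{H_x : {0,1}ⁿ → {0,1}^ℓ}_{x ∈ X}` is a family of **universal** hash functions. Then, for any random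
> variables `W` and `I`, `SD((H_X(W), X, I), (U_ℓ, X, I)) ≤ ½ √(2^{−H̃∞(W|I)} 2^ℓ)`.

> **Arora–Barak 2009, Lemma 21.26** (Leftover hash lemma) is likewise proved from the collision
> probability, where "the probability that `h(x) = h(x')` for `x ≠ x'`" is bounded by `2^{−m}` — i.e.
> from universality `Pr_k[h_k x = h_k x'] ≤ 1/|γ|` (`x ≠ x'`), not from pairwise independence.

This file proves the three tree statements with `IsPairwiseIndep K h S` REPLACED by the counting
universality hypothesis `∀ a ≠ a' ∈ S, #{k ∈ K : h_k a = h_k a'} · |γ| ≤ |K|` (the hypothesis shape of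
the flat-source precedent `LeftoverHash.card_collisions_keyed_mul_le_of_universal` /
`leftoverHash_flat_of_universal` in `LeftoverHashUniversal.lean`; a pairwise independent family
satisfies it with equality, `IsPairwiseIndep.card_collide`):

* `LeftoverHash.card_collisions_keyed_comp_mul_le_of_universal` — collision count of the keyed hash
  of a general source `X = x(U_W)`: `#{((k,w),(k',w')) : (k, h_k(x w)) = (k', h_{k'}(x w'))} · |γ| ≤
  |K| · (C_x · |γ| + |W|²)`;
* `LeftoverHash.leftoverHash_collProb_of_universal` — `Δ((K, h_K(X)), U_{K × γ}) ≤ ½ √(|γ| · CP(X))`;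
* `LeftoverHash.leftoverHash_minEntropy_of_universal` — fibre bound `M` (min-entropy `≥ log₂(|W|/M)`)
  gives `≤ ½ √(|γ| · M / |W|)`;
* `LeftoverHash.leftoverHash_cond_test_of_universal` — **DORS 2008 Lemma 2.4 as printed (universal
  family), test form with side information**: fibre bound `M c` on each slice `{w : z w = c}` gives, for
  every `[0,1]`-valued test `F` of (side information, key, hash value),
  `|E[F(z, K, h_K(x))] − E[F(z, K, U_γ)]| ≤ ½ √(|γ| · (Σ_{c ∈ z(W)} M c) / |W|)`;
* `LeftoverHash.leftoverHash_cond_minEntropy_test_of_universal` (worst-case conditional min-entropy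
  `k` on every slice: `≤ ½ √(|γ|/2ᵏ)`) and `LeftoverHash.leftoverHash_cond_good_test_of_universal`
  (min-entropy `k` on the slices of a set `Good`: `≤ ½ √(|γ| (2^{−k} + Pr[z ∉ Good]))`).

The proofs are those of the pairwise-independent tree versions VERBATIM (Arora–Barak's collision
count; Dodis et al.'s mixture over slices + Cauchy–Schwarz for Jensen), whose only use of pairwise
independence is the collision identity `#{k : h_k a = h_k a'} · |γ| = |K|` — replaced here by the
inequality `≤`, which is the universality hypothesis itself. Everything is PROVED; no definitions,
no named facts. (Typed for the certified-randomness extraction ledger, whose deployed Toeplitz family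
is universal but not pairwise independent: `T·0 = 0` for every key.)

## References

* Y. Dodis, R. Ostrovsky, L. Reyzin, A. Smith, *Fuzzy extractors: how to generate strong keys from
  biometrics and other noisy data*, SIAM J. Comput. 38(1) (2008) 97–139, doi:10.1137/060651380
  (arXiv:cs/0602007), §2.4, Lemma 2.4 (generalized LHL, universal family) and its proof.
* S. Arora, B. Barak, *Computational Complexity: A Modern Approach*, CUP 2009, Lemma 21.26 and its
  proof (collision probability), §21.5.2.
* J. L. Carter, M. N. Wegman, *Universal classes of hash functions*, J. Comput. Syst. Sci. 18 (1979)
  143–154 (universality).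
* J. Håstad, R. Impagliazzo, L. A. Levin, M. Luby, *A pseudorandom generator from any one-way
  function*, SIAM J. Comput. 28 (1999), Lemma 4.8 (Leftover Hash Lemma).
-/

namespace Literature.Computability.Cryptography

namespace LeftoverHash

open Finset

/-! ### Min-entropy sources, universal family -/

section MinEntropyUniversal

variable {ω α γ κ : Type*}

variable [DecidableEq α] [DecidableEq γ] [Fintype γ]

/-- **Collision count of the keyed hash of a general source, universal family**: if
`#{k ∈ K : h_k a = h_k a'} · |γ| ≤ |K|` for all `a ≠ a'` in `S ⊇ x(W)`, then
`#{((k,w),(k',w')) : (k, h_k(x w)) = (k', h_{k'}(x w'))} · |γ| ≤ |K| · (C_x · |γ| + |W|²)`, where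
`C_x = #{(w, w') ∈ W² : x w = x w'}` counts the source collisions. Same proof as the tree's
`card_collisions_keyed_comp_mul_le` (Arora–Barak 2009, proof of Lemma 21.26: "the probability that
`h = h'` times (the probability that `x = x'` plus the probability that `h(x) = h(x')` for `x ≠ x'`)"),
whose only use of pairwise independence is this collision bound.
[cite: AroraBarak2009, Lemma 21.26 (proof)] -/
theorem card_collisions_keyed_comp_mul_le_of_universal [DecidableEq κ] [DecidableEq ω] {K : Finset κ}
    {h : κ → α → γ} {S : Finset α}
    (hU : ∀ a ∈ S, ∀ a' ∈ S, a ≠ a' → (K.filter fun k => h k a = h k a').card * Fintype.card γ ≤ K.card)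
    {W : Finset ω} {x : ω → α} (hx : ∀ w ∈ W, x w ∈ S) :
    (((K ×ˢ W) ×ˢ (K ×ˢ W)).filter fun p => keyed (fun k w => h k (x w)) p.1 = keyed (fun k w => h k (x w)) p.2).card * Fintype.card γ ≤
      K.card * (((W ×ˢ W).filter fun q => x q.1 = x q.2).card * Fintype.card γ + W.card * W.card) := by
  classical
  -- split the colliding pairs according to `x w = x w'` or not
  set C := ((K ×ˢ W) ×ˢ (K ×ˢ W)).filter fun p => keyed (fun k w => h k (x w)) p.1 = keyed (fun k w => h k (x w)) p.2 with hC
  set Csame := C.filter fun p => x p.1.2 = x p.2.2 with hCs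
  set Coff := C.filter fun p => x p.1.2 ≠ x p.2.2 with hCo
  set Cx := (W ×ˢ W).filter fun q => x q.1 = x q.2 with hCx
  have hsplit : C.card = Csame.card + Coff.card := by
    rw [hCs, hCo, ← Finset.card_filter_add_card_filter_not (p := fun p : (κ × ω) × (κ × ω) => x p.1.2 = x p.2.2)]
  -- same source value: determined by `(k, (w, w'))` with `(w, w')` a source collision
  have hsame : Csame.card ≤ K.card * Cx.card := by
    have hinj : Set.InjOn (fun p : (κ × ω) × (κ × ω) => (p.1.1, (p.1.2, p.2.2))) Csame := by
      intro p hp q hq heq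
      have hk := congrArg Prod.fst (Finset.mem_filter.1 (Finset.mem_filter.1 hp).1).2
      have hl := congrArg Prod.fst (Finset.mem_filter.1 (Finset.mem_filter.1 hq).1).2
      dsimp only [keyed] at hk hl
      rcases p with ⟨⟨k, w⟩, ⟨k', w'⟩⟩
      rcases q with ⟨⟨l, v⟩, ⟨l', v'⟩⟩
      simp only [Prod.mk.injEq] at heq hk hl ⊢
      obtain ⟨rfl, rfl, rfl⟩ := heq
      exact ⟨⟨rfl, rfl⟩, hk.symm.trans hl, rfl⟩
    have hsub : Csame.image (fun p : (κ × ω) × (κ × ω) => (p.1.1, (p.1.2, p.2.2))) ⊆ K ×ˢ Cx := by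
      intro t ht
      obtain ⟨p, hp, rfl⟩ := Finset.mem_image.1 ht
      have hp1 := Finset.mem_filter.1 hp
      have hp2 := Finset.mem_filter.1 hp1.1
      have hmem := Finset.mem_product.1 hp2.1
      refine Finset.mem_product.2 ⟨(Finset.mem_product.1 hmem.1).1, Finset.mem_filter.2 ⟨?_, hp1.2⟩⟩
      exact Finset.mem_product.2 ⟨(Finset.mem_product.1 hmem.1).2, (Finset.mem_product.1 hmem.2).2⟩
    calc Csame.card = (Csame.image fun p => (p.1.1, (p.1.2, p.2.2))).card := (Finset.card_image_of_injOn hinj).symm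
      _ ≤ (K ×ˢ Cx).card := Finset.card_le_card hsub
      _ = K.card * Cx.card := Finset.card_product _ _
  -- distinct source values: inject into triples `(k, (w, w'))` with `x w ≠ x w'`,
  -- `h_k (x w) = h_k (x w')`, and count those fibrewise over `(w, w')`: `|K|/|γ|` keys each
  have hoff : Coff.card * Fintype.card γ ≤ K.card * (W.card * W.card) := by
    set OD := (W ×ˢ W).filter fun q : ω × ω => x q.1 ≠ x q.2 with hOD
    set Z : Finset (κ × (ω × ω)) := (K ×ˢ OD).filter fun t => h t.1 (x t.2.1) = h t.1 (x t.2.2) with hZ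
    have hinj : Set.InjOn (fun p : (κ × ω) × (κ × ω) => (p.1.1, (p.1.2, p.2.2))) Coff := by
      intro p hp q hq heq
      have hk := congrArg Prod.fst (Finset.mem_filter.1 (Finset.mem_filter.1 hp).1).2
      have hl := congrArg Prod.fst (Finset.mem_filter.1 (Finset.mem_filter.1 hq).1).2
      dsimp only [keyed] at hk hl
      rcases p with ⟨⟨k, w⟩, ⟨k', w'⟩⟩
      rcases q with ⟨⟨l, v⟩, ⟨l', v'⟩⟩
      simp only [Prod.mk.injEq] at heq hk hl ⊢
      obtain ⟨rfl, rfl, rfl⟩ := heq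
      exact ⟨⟨rfl, rfl⟩, hk.symm.trans hl, rfl⟩
    have himg : Coff.image (fun p : (κ × ω) × (κ × ω) => (p.1.1, (p.1.2, p.2.2))) ⊆ Z := by
      intro t ht
      obtain ⟨p, hp, rfl⟩ := Finset.mem_image.1 ht
      have hp1 := Finset.mem_filter.1 hp
      have hp2 := Finset.mem_filter.1 hp1.1
      have hmem := Finset.mem_product.1 hp2.1
      have hk := congrArg Prod.fst hp2.2
      have hh := congrArg Prod.snd hp2.2
      dsimp only [keyed] at hk hh
      refine Finset.mem_filter.2 ⟨Finset.mem_product.2 ⟨(Finset.mem_product.1 hmem.1).1, ?_⟩, ?_⟩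
      · exact Finset.mem_filter.2 ⟨Finset.mem_product.2 ⟨(Finset.mem_product.1 hmem.1).2, (Finset.mem_product.1 hmem.2).2⟩, hp1.2⟩
      · show h p.1.1 (x p.1.2) = h p.1.1 (x p.2.2)
        rw [hh, hk]
    have hfib : ∀ q ∈ OD, (Z.filter fun t => t.2 = q).card = (K.filter fun k => h k (x q.1) = h k (x q.2)).card := by
      intro q hq
      rw [← Finset.card_image_of_injective (K.filter fun k => h k (x q.1) = h k (x q.2))
        (f := fun k : κ => (k, q)) (fun a b hab => (Prod.mk.inj hab).1)]
      congr 1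
      ext ⟨k, q'⟩
      simp only [hZ, Finset.mem_filter, Finset.mem_product, Finset.mem_image, Prod.mk.injEq]
      constructor
      · rintro ⟨⟨⟨hk, _⟩, hh⟩, rfl⟩
        exact ⟨k, ⟨hk, hh⟩, rfl, rfl⟩
      · rintro ⟨k₀, ⟨hk₀, hh⟩, rfl, rfl⟩
        exact ⟨⟨⟨hk₀, hq⟩, hh⟩, rfl⟩
    have hZcount : Z.card = ∑ q ∈ OD, (K.filter fun k => h k (x q.1) = h k (x q.2)).card := by
      rw [Finset.card_eq_sum_card_fiberwise (f := fun t : κ × (ω × ω) => t.2) (t := OD)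
        (fun t ht => (Finset.mem_product.1 (Finset.mem_filter.1 ht).1).2)]
      exact Finset.sum_congr rfl hfib
    have hZ' : Z.card * Fintype.card γ ≤ K.card * (W.card * W.card) := by
      calc Z.card * Fintype.card γ = ∑ q ∈ OD, (K.filter fun k => h k (x q.1) = h k (x q.2)).card * Fintype.card γ := by
            rw [hZcount, Finset.sum_mul]
        _ ≤ ∑ _q ∈ OD, K.card := by
            refine Finset.sum_le_sum fun q hq => ?_
            have hq' := Finset.mem_filter.1 hq
            have hqW := Finset.mem_product.1 hq'.1
            exact hU _ (hx _ hqW.1) _ (hx _ hqW.2) hq'.2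
        _ ≤ ∑ _q ∈ W ×ˢ W, K.card := Finset.sum_le_sum_of_subset_of_nonneg (Finset.filter_subset _ _) fun _ _ _ => Nat.zero_le _
        _ = K.card * (W.card * W.card) := by rw [Finset.sum_const, Finset.card_product, smul_eq_mul]; ring
    have hle : Coff.card ≤ Z.card :=
      (Finset.card_image_of_injOn hinj).symm.le.trans (Finset.card_le_card himg)
    exact (Nat.mul_le_mul_right _ hle).trans hZ'
  calc C.card * Fintype.card γ = Csame.card * Fintype.card γ + Coff.card * Fintype.card γ := by rw [hsplit, add_mul]
    _ ≤ K.card * Cx.card * Fintype.card γ + K.card * (W.card * W.card) := add_le_add (Nat.mul_le_mul_right _ hsame) hoff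
    _ = K.card * (Cx.card * Fintype.card γ + W.card * W.card) := by ring

/-- **Leftover Hash Lemma, collision-probability form, universal family**: for a family
`(h_k)_{k ∈ K}` into a finite set `γ`, universal on a set `S ⊇ x(W)`
(`#{k : h_k a = h_k a'} · |γ| ≤ |K|` for `a ≠ a'` in `S`), and the source `X = x(U_W)` (`W ≠ ∅`),
`Δ((K, h_K(X)), U_{K × γ}) ≤ ½ √(|γ| · CP(X))`.
[Arora–Barak 2009, Lemma 21.26 (proof); Håstad–Impagliazzo–Levin–Luby 1999, Lemma 4.8]
[cite: AroraBarak2009, Lemma 21.26 (proof)] -/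
theorem leftoverHash_collProb_of_universal [DecidableEq κ] [DecidableEq ω] {K : Finset κ}
    (hKne : K.Nonempty) {h : κ → α → γ} {S : Finset α} [Nonempty γ]
    (hU : ∀ a ∈ S, ∀ a' ∈ S, a ≠ a' → (K.filter fun k => h k a = h k a').card * Fintype.card γ ≤ K.card)
    {W : Finset ω} (hW : W.Nonempty) {x : ω → α} (hx : ∀ w ∈ W, x w ∈ S) :
    distUnif (K ×ˢ W) (keyed fun k w => h k (x w)) (K ×ˢ (Finset.univ : Finset γ)) ≤
      2⁻¹ * Real.sqrt (Fintype.card γ * collProb W x) := by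
  classical
  have hKc : (0 : ℝ) < K.card := by exact_mod_cast hKne.card_pos
  have hWc : (0 : ℝ) < W.card := by exact_mod_cast hW.card_pos
  have hγ : (0 : ℝ) < Fintype.card γ := by exact_mod_cast Fintype.card_pos
  have hmaps : ∀ p ∈ K ×ˢ W, keyed (fun k w => h k (x w)) p ∈ K ×ˢ (Finset.univ : Finset γ) := fun p hp =>
    Finset.mem_product.2 ⟨(Finset.mem_product.1 hp).1, Finset.mem_univ _⟩
  have hTne : (K ×ˢ (Finset.univ : Finset γ)).Nonempty := hKne.product Finset.univ_nonempty
  refine (distUnif_le_sqrt (hKne.product hW) hTne hmaps).trans ?_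
  refine mul_le_mul_of_nonneg_left (Real.sqrt_le_sqrt ?_) (by norm_num)
  -- `|T| · CP − 1 ≤ |γ| · CP_x`
  have hcoll := card_collisions_keyed_comp_mul_le_of_universal hU hx
  set C := (((K ×ˢ W) ×ˢ (K ×ˢ W)).filter fun p => keyed (fun k w => h k (x w)) p.1 = keyed (fun k w => h k (x w)) p.2).card with hC
  set Cx := ((W ×ˢ W).filter fun q => x q.1 = x q.2).card with hCx
  have hcollR : (C : ℝ) * Fintype.card γ ≤ K.card * (Cx * Fintype.card γ + W.card * W.card) := by
    exact_mod_cast hcoll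
  unfold collProb
  rw [← hC, ← hCx, Finset.card_product, Finset.card_product, Finset.card_univ, Nat.cast_mul, Nat.cast_mul]
  rw [sub_le_iff_le_add]
  rw [show ((K.card : ℝ) * (Fintype.card γ : ℝ)) * (C / ((K.card : ℝ) * W.card) ^ 2)
      = (C * Fintype.card γ) / (K.card * (W.card * W.card)) by field_simp]
  rw [div_le_iff₀ (by positivity)]
  calc (C : ℝ) * Fintype.card γ ≤ K.card * (Cx * Fintype.card γ + W.card * W.card) := hcollR
    _ = (Fintype.card γ * (Cx / (W.card : ℝ) ^ 2) + 1) * (K.card * (W.card * W.card)) := by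
        field_simp

/-- **Leftover Hash Lemma for min-entropy sources, universal family**: if every fibre of `x` in `W`
has at most `M` points (so `X = x(U_W)` has min-entropy `≥ log₂(|W|/M)`) and the family is universal on
`S ⊇ x(W)`, then `Δ((K, h_K(X)), U_{K × γ}) ≤ ½ √(|γ| · M / |W|)`. The flat case is the tree's
`leftoverHash_flat_of_universal`. [Arora–Barak 2009, Lemma 21.26; Håstad–Impagliazzo–Levin–Luby 1999,
Lemma 4.8] [cite: AroraBarak2009, Lemma 21.26] -/
theorem leftoverHash_minEntropy_of_universal [DecidableEq κ] [DecidableEq ω] {K : Finset κ}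
    (hKne : K.Nonempty) {h : κ → α → γ} {S : Finset α} [Nonempty γ]
    (hU : ∀ a ∈ S, ∀ a' ∈ S, a ≠ a' → (K.filter fun k => h k a = h k a').card * Fintype.card γ ≤ K.card)
    {W : Finset ω} (hW : W.Nonempty) {x : ω → α} (hx : ∀ w ∈ W, x w ∈ S) {M : ℕ}
    (hM : ∀ a, (fib W x a).card ≤ M) :
    distUnif (K ×ˢ W) (keyed fun k w => h k (x w)) (K ×ˢ (Finset.univ : Finset γ)) ≤
      2⁻¹ * Real.sqrt (Fintype.card γ * M / W.card) := by
  refine (leftoverHash_collProb_of_universal hKne hU hW hx).trans ?_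
  refine mul_le_mul_of_nonneg_left (Real.sqrt_le_sqrt ?_) (by norm_num)
  rw [mul_div_assoc]
  exact mul_le_mul_of_nonneg_left (collProb_le_of_card_fib_le hW hM) (Nat.cast_nonneg _)

end MinEntropyUniversal

/-! ### Side information, universal family (Dodis–Ostrovsky–Reyzin–Smith 2008, Lemma 2.4 as printed) -/

section ConditionalUniversal

variable {ω ζ α γ κ : Type*} [DecidableEq ζ] [DecidableEq α] [DecidableEq γ] [Fintype γ] [DecidableEq κ]

variable [Nonempty γ]

/-- **Generalized Leftover Hash Lemma, test form, UNIVERSAL family** (Dodis–Ostrovsky–Reyzin–Smith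
2008, Lemma 2.4, as printed: "Assume `{H_x}` is a family of universal hash functions. Then, for any
random variables `W` and `I`, `SD((H_X(W), X, I), (U_ℓ, X, I)) ≤ ½ √(2^{-H̃∞(W|I)} 2^ℓ)`", with the
printed proof: condition on the side information, apply the Leftover Hash Lemma on each slice, and use
Jensen's inequality `E[√Z] ≤ √(E[Z])`). Here the joint source is `w ↦ (z w, x w)`, `w` uniform on
`W ≠ ∅` (side information `z`, hashed value `x`), the family `(h_k)_{k ∈ K}` is UNIVERSAL on `S ⊇ x(W)`
in counting form (`#{k ∈ K : h_k a = h_k a'} · |γ| ≤ |K|` for `a ≠ a'` in `S`), and the conditional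
min-entropy is presented by a fibre bound `M c` on each slice (`|{w ∈ W : z w = c, x w = a}| ≤ M c` for
all `a`), so that `E_c[2^{-H∞(x | z = c)}] ≤ (Σ_c M c)/|W|`. For every test `F` of the side information
and the pair (key, hash value) with `0 ≤ F ≤ 1`:
`|E[F(z, K, h_K(x))] − E[F(z, K, U_γ)]| ≤ ½ √(|γ| · (Σ_{c ∈ z(W)} M c) / |W|)`.
The tree's `leftoverHash_cond_test` is the pairwise-independent special case.
[cite: DodisEtAl2008, Lemma 2.4] -/
theorem leftoverHash_cond_test_of_universal [DecidableEq ω] {K : Finset κ} (hKne : K.Nonempty)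
    {h : κ → α → γ} {S : Finset α}
    (hU : ∀ a ∈ S, ∀ a' ∈ S, a ≠ a' → (K.filter fun k => h k a = h k a').card * Fintype.card γ ≤ K.card)
    {W : Finset ω} (hW : W.Nonempty) {z : ω → ζ} {x : ω → α}
    (hx : ∀ w ∈ W, x w ∈ S) (M : ζ → ℕ) (hM : ∀ c a, (W.filter fun w => z w = c ∧ x w = a).card ≤ M c)
    (F : ζ → κ × γ → ℝ) (hF0 : ∀ c v, 0 ≤ F c v) (hF1 : ∀ c v, F c v ≤ 1) :
    |(∑ k ∈ K, ∑ w ∈ W, F (z w) (k, h k (x w))) / (K.card * W.card) -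
        (∑ k ∈ K, ∑ w ∈ W, ∑ u : γ, F (z w) (k, u)) / (K.card * W.card * Fintype.card γ)| ≤
      2⁻¹ * Real.sqrt (Fintype.card γ * (∑ c ∈ W.image z, (M c : ℝ)) / W.card) := by
  classical
  have hKc : (0 : ℝ) < K.card := by exact_mod_cast hKne.card_pos
  have hWc : (0 : ℝ) < W.card := by exact_mod_cast hW.card_pos
  have hγ : (0 : ℝ) < Fintype.card γ := by exact_mod_cast Fintype.card_pos
  set Z := W.image z with hZ
  have hmaps : ∀ w ∈ W, z w ∈ Z := fun w hw => Finset.mem_image_of_mem z hw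
  -- the per-slice averages
  set A : ζ → ℝ := fun c =>
    (∑ p ∈ K ×ˢ W.filter (fun w => z w = c), F c (keyed (fun k w => h k (x w)) p)) / ((K ×ˢ W.filter (fun w => z w = c)).card : ℝ) with hA
  set B : ζ → ℝ := fun c =>
    (∑ v ∈ K ×ˢ (Finset.univ : Finset γ), F c v) / ((K ×ˢ (Finset.univ : Finset γ)).card : ℝ) with hB
  set p : ζ → ℝ := fun c => ((W.filter (fun w => z w = c)).card : ℝ) / W.card with hp
  -- Step 1: both averages are mixtures over the slices
  have hreal : (∑ k ∈ K, ∑ w ∈ W, F (z w) (k, h k (x w))) / (K.card * W.card) = ∑ c ∈ Z, p c * A c := by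
    have h1 : ∑ k ∈ K, ∑ w ∈ W, F (z w) (k, h k (x w)) =
        ∑ c ∈ Z, ∑ k ∈ K, ∑ w ∈ W.filter (fun w => z w = c), F c (k, h k (x w)) := by
      rw [Finset.sum_comm]
      rw [← Finset.sum_fiberwise_of_maps_to hmaps (fun w => ∑ k ∈ K, F (z w) (k, h k (x w)))]
      refine Finset.sum_congr rfl fun c _ => ?_
      rw [Finset.sum_comm]
      refine Finset.sum_congr rfl fun k _ => Finset.sum_congr rfl fun w hw => ?_
      rw [(Finset.mem_filter.1 hw).2]
    rw [h1, Finset.sum_div]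
    refine Finset.sum_congr rfl fun c hc => ?_
    have hsc : (0 : ℝ) < (W.filter (fun w => z w = c)).card := by
      exact_mod_cast (Finset.fiber_nonempty_iff_mem_image.mpr hc).card_pos
    simp only [hA, hp, Finset.sum_product, keyed, Finset.card_product, Nat.cast_mul]
    field_simp
  have hideal : (∑ k ∈ K, ∑ w ∈ W, ∑ u : γ, F (z w) (k, u)) / (K.card * W.card * Fintype.card γ) =
      ∑ c ∈ Z, p c * B c := by
    have h1 : ∑ k ∈ K, ∑ w ∈ W, ∑ u : γ, F (z w) (k, u) =
        ∑ c ∈ Z, (W.filter (fun w => z w = c)).card * ∑ k ∈ K, ∑ u : γ, F c (k, u) := by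
      rw [Finset.sum_comm]
      rw [← Finset.sum_fiberwise_of_maps_to hmaps (fun w => ∑ k ∈ K, ∑ u : γ, F (z w) (k, u))]
      refine Finset.sum_congr rfl fun c _ => ?_
      rw [Finset.sum_congr rfl (g := fun _ => ∑ k ∈ K, ∑ u : γ, F c (k, u))
        (fun w hw => by rw [(Finset.mem_filter.1 hw).2]), Finset.sum_const, nsmul_eq_mul]
    rw [h1, Finset.sum_div]
    refine Finset.sum_congr rfl fun c _ => ?_
    simp only [hB, hp, Finset.sum_product, Finset.card_product, Finset.card_univ, Nat.cast_mul]
    field_simp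
  -- Step 2: on each slice, the Leftover Hash Lemma bounds the test difference
  have hslice : ∀ c ∈ Z, |A c - B c| ≤ 2⁻¹ * Real.sqrt (Fintype.card γ * M c / (W.filter (fun w => z w = c)).card) := by
    intro c hc
    have hsne : (W.filter (fun w => z w = c)).Nonempty := Finset.fiber_nonempty_iff_mem_image.mpr hc
    have hxs : ∀ w ∈ W.filter (fun w => z w = c), x w ∈ S := fun w hw => hx w (Finset.mem_filter.1 hw).1
    have hT : ∀ q ∈ K ×ˢ W.filter (fun w => z w = c), keyed (fun k w => h k (x w)) q ∈ K ×ˢ (Finset.univ : Finset γ) :=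
      fun q hq => Finset.mem_product.2 ⟨(Finset.mem_product.1 hq).1, Finset.mem_univ _⟩
    refine (abs_avg_sub_unifAvg_le_distUnif (hKne.product hsne) hT (hKne.product Finset.univ_nonempty)
      (fun v _ => hF0 c v) (fun v _ => hF1 c v)).trans ?_
    refine leftoverHash_minEntropy_of_universal hKne hU hsne hxs (M := M c) fun a => ?_
    rw [fib_filter_val]
    exact hM c a
  -- Step 3: mix and apply Cauchy–Schwarz (Jensen for the square root)
  have hp0 : ∀ c, 0 ≤ p c := fun c => by positivity
  have hpsum : ∑ c ∈ Z, p c = 1 := by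
    simp only [hp, ← Finset.sum_div]
    rw [← Nat.cast_sum, sum_card_filter_val, div_self hWc.ne']
  rw [hreal, hideal, ← Finset.sum_sub_distrib]
  calc |∑ c ∈ Z, (p c * A c - p c * B c)|
      ≤ ∑ c ∈ Z, |p c * A c - p c * B c| := Finset.abs_sum_le_sum_abs _ _
    _ ≤ ∑ c ∈ Z, p c * (2⁻¹ * Real.sqrt (Fintype.card γ * M c / (W.filter (fun w => z w = c)).card)) := by
        refine Finset.sum_le_sum fun c hc => ?_
        rw [← mul_sub, abs_mul, abs_of_nonneg (hp0 c)]
        exact mul_le_mul_of_nonneg_left (hslice c hc) (hp0 c)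
    _ = 2⁻¹ * ∑ c ∈ Z, Real.sqrt (p c) * Real.sqrt (p c * (Fintype.card γ * M c / (W.filter (fun w => z w = c)).card)) := by
        rw [Finset.mul_sum]
        refine Finset.sum_congr rfl fun c _ => ?_
        have hsq : Real.sqrt (p c) * Real.sqrt (p c * (Fintype.card γ * M c / (W.filter (fun w => z w = c)).card)) =
            p c * Real.sqrt (Fintype.card γ * M c / (W.filter (fun w => z w = c)).card) := by
          rw [Real.sqrt_mul (hp0 c), ← mul_assoc, Real.mul_self_sqrt (hp0 c)]
        rw [hsq]
        ring
    _ ≤ 2⁻¹ * (Real.sqrt (∑ c ∈ Z, Real.sqrt (p c) ^ 2) *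
          Real.sqrt (∑ c ∈ Z, Real.sqrt (p c * (Fintype.card γ * M c / (W.filter (fun w => z w = c)).card)) ^ 2)) := by
        refine mul_le_mul_of_nonneg_left ?_ (by norm_num)
        exact Real.sum_mul_le_sqrt_mul_sqrt _ _ _
    _ = 2⁻¹ * Real.sqrt (Fintype.card γ * (∑ c ∈ Z, (M c : ℝ)) / W.card) := by
        congr 1
        have h1 : ∑ c ∈ Z, Real.sqrt (p c) ^ 2 = 1 := by
          rw [← hpsum]
          exact Finset.sum_congr rfl fun c _ => Real.sq_sqrt (hp0 c)
        have h2 : ∑ c ∈ Z, Real.sqrt (p c * (Fintype.card γ * M c / (W.filter (fun w => z w = c)).card)) ^ 2 =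
            Fintype.card γ * (∑ c ∈ Z, (M c : ℝ)) / W.card := by
          rw [Finset.mul_sum, Finset.sum_div]
          refine Finset.sum_congr rfl fun c hc => ?_
          have hsc : (0 : ℝ) < (W.filter (fun w => z w = c)).card := by
            exact_mod_cast (Finset.fiber_nonempty_iff_mem_image.mpr hc).card_pos
          rw [Real.sq_sqrt (by positivity)]
          simp only [hp]
          field_simp
        rw [h1, h2, Real.sqrt_one, one_mul]

/-- **Generalized Leftover Hash Lemma for worst-case conditional min-entropy, universal family**: if
on every slice the source has min-entropy `k` (`|{w ∈ W : z w = c, x w = a}| · 2ᵏ ≤ |W_c|`) and the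
family is universal on `S ⊇ x(W)`, then for every `[0,1]`-valued test
`|E[F(z, K, h_K(x))] − E[F(z, K, U_γ)]| ≤ ½ √(|γ| / 2ᵏ)`. [cite: DodisEtAl2008, Lemma 2.4] -/
theorem leftoverHash_cond_minEntropy_test_of_universal [DecidableEq ω] {K : Finset κ}
    (hKne : K.Nonempty) {h : κ → α → γ} {S : Finset α}
    (hU : ∀ a ∈ S, ∀ a' ∈ S, a ≠ a' → (K.filter fun k => h k a = h k a').card * Fintype.card γ ≤ K.card)
    {W : Finset ω} (hW : W.Nonempty) {z : ω → ζ} {x : ω → α}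
    (hx : ∀ w ∈ W, x w ∈ S) {k : ℕ}
    (hk : ∀ c a, (W.filter fun w => z w = c ∧ x w = a).card * 2 ^ k ≤ (W.filter (fun w => z w = c)).card)
    (F : ζ → κ × γ → ℝ) (hF0 : ∀ c v, 0 ≤ F c v) (hF1 : ∀ c v, F c v ≤ 1) :
    |(∑ k ∈ K, ∑ w ∈ W, F (z w) (k, h k (x w))) / (K.card * W.card) -
        (∑ k ∈ K, ∑ w ∈ W, ∑ u : γ, F (z w) (k, u)) / (K.card * W.card * Fintype.card γ)| ≤
      2⁻¹ * Real.sqrt (Fintype.card γ / 2 ^ k) := by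
  have hWc : (0 : ℝ) < W.card := by exact_mod_cast hW.card_pos
  refine (leftoverHash_cond_test_of_universal hKne hU hW hx (fun c => (W.filter (fun w => z w = c)).card / 2 ^ k)
    (fun c a => (Nat.le_div_iff_mul_le (Nat.two_pow_pos k)).2 (hk c a)) F hF0 hF1).trans ?_
  refine mul_le_mul_of_nonneg_left (Real.sqrt_le_sqrt ?_) (by norm_num)
  have hsum : (∑ c ∈ W.image z, (((W.filter (fun w => z w = c)).card / 2 ^ k : ℕ) : ℝ)) ≤ W.card / 2 ^ k := by
    calc (∑ c ∈ W.image z, (((W.filter (fun w => z w = c)).card / 2 ^ k : ℕ) : ℝ))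
        ≤ ∑ c ∈ W.image z, ((W.filter (fun w => z w = c)).card : ℝ) / 2 ^ k :=
          Finset.sum_le_sum fun c _ => by
            have := Nat.cast_div_le (m := (W.filter (fun w => z w = c)).card) (n := 2 ^ k) (α := ℝ)
            simpa using this
      _ = W.card / 2 ^ k := by
          rw [← Finset.sum_div, ← Nat.cast_sum, sum_card_filter_val]
  rw [mul_div_assoc]
  calc (Fintype.card γ : ℝ) * ((∑ c ∈ W.image z, (((W.filter (fun w => z w = c)).card / 2 ^ k : ℕ) : ℝ)) / W.card)
      ≤ Fintype.card γ * ((W.card / 2 ^ k) / W.card) := by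
        refine mul_le_mul_of_nonneg_left (div_le_div_of_nonneg_right hsum hWc.le) (Nat.cast_nonneg _)
    _ = Fintype.card γ / 2 ^ k := by field_simp

/-- **Generalized Leftover Hash Lemma with a good set of side-information values, universal
family**: if the fibre bound `· 2ᵏ ≤ |W_c|` holds for every `c ∈ Good` and the family is universal on
`S ⊇ x(W)`, then for every `[0,1]`-valued test
`|E[F(z, K, h_K(x))] − E[F(z, K, U_γ)]| ≤ ½ √(|γ| · (2^{−k} + Pr_w[z w ∉ Good]))`.
[Dodis–Ostrovsky–Reyzin–Smith 2008, Lemma 2.4 with Lemma 2.2(a)] [cite: DodisEtAl2008, Lemma 2.4] -/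
theorem leftoverHash_cond_good_test_of_universal [DecidableEq ω] {K : Finset κ}
    (hKne : K.Nonempty) {h : κ → α → γ} {S : Finset α}
    (hU : ∀ a ∈ S, ∀ a' ∈ S, a ≠ a' → (K.filter fun k => h k a = h k a').card * Fintype.card γ ≤ K.card)
    {W : Finset ω} (hW : W.Nonempty) {z : ω → ζ} {x : ω → α}
    (hx : ∀ w ∈ W, x w ∈ S) {k : ℕ} (Good : Finset ζ)
    (hk : ∀ c ∈ Good, ∀ a, (W.filter fun w => z w = c ∧ x w = a).card * 2 ^ k ≤ (W.filter (fun w => z w = c)).card)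
    (F : ζ → κ × γ → ℝ) (hF0 : ∀ c v, 0 ≤ F c v) (hF1 : ∀ c v, F c v ≤ 1) :
    |(∑ k ∈ K, ∑ w ∈ W, F (z w) (k, h k (x w))) / (K.card * W.card) -
        (∑ k ∈ K, ∑ w ∈ W, ∑ u : γ, F (z w) (k, u)) / (K.card * W.card * Fintype.card γ)| ≤
      2⁻¹ * Real.sqrt (Fintype.card γ * (1 / 2 ^ k + ((W.filter fun w => z w ∉ Good).card : ℝ) / W.card)) := by
  classical
  have hWc : (0 : ℝ) < W.card := by exact_mod_cast hW.card_pos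
  -- the fibre bound: `|W_c| / 2ᵏ` on good slices, `|W_c|` on bad ones
  set M : ζ → ℕ := fun c => if c ∈ Good then (W.filter (fun w => z w = c)).card / 2 ^ k else (W.filter (fun w => z w = c)).card with hMdef
  have hM : ∀ c a, (W.filter fun w => z w = c ∧ x w = a).card ≤ M c := by
    intro c a
    simp only [hMdef]
    split_ifs with hc
    · exact (Nat.le_div_iff_mul_le (Nat.two_pow_pos k)).2 (hk c hc a)
    · rw [← fib_filter_val]
      exact Finset.card_filter_le _ _
  refine (leftoverHash_cond_test_of_universal hKne hU hW hx M hM F hF0 hF1).trans ?_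
  refine mul_le_mul_of_nonneg_left (Real.sqrt_le_sqrt ?_) (by norm_num)
  -- `Σ_c M c ≤ |W|/2ᵏ + |W_bad|`
  have hbad : ∑ c ∈ (W.image z).filter (fun c => c ∉ Good), ((W.filter (fun w => z w = c)).card : ℝ) =
      ((W.filter fun w => z w ∉ Good).card : ℝ) := by
    rw [← Nat.cast_sum]
    congr 1
    rw [Finset.card_eq_sum_card_fiberwise (f := z) (t := (W.image z).filter fun c => c ∉ Good)
      (fun w hw => Finset.mem_filter.2 ⟨Finset.mem_image_of_mem z (Finset.mem_filter.1 hw).1, (Finset.mem_filter.1 hw).2⟩)]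
    refine Finset.sum_congr rfl fun c hc => ?_
    congr 1
    ext w
    simp only [Finset.mem_filter]
    constructor
    · rintro ⟨hw, hwc⟩
      exact ⟨⟨hw, by rw [hwc]; exact (Finset.mem_filter.1 hc).2⟩, hwc⟩
    · rintro ⟨⟨hw, -⟩, hwc⟩
      exact ⟨hw, hwc⟩
  have hsum : (∑ c ∈ W.image z, (M c : ℝ)) ≤ W.card / 2 ^ k + ((W.filter fun w => z w ∉ Good).card : ℝ) := by
    rw [← Finset.sum_filter_add_sum_filter_not (W.image z) (fun c => c ∈ Good)]
    refine add_le_add ?_ ?_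
    · calc ∑ c ∈ (W.image z).filter (fun c => c ∈ Good), (M c : ℝ)
          ≤ ∑ c ∈ (W.image z).filter (fun c => c ∈ Good), ((W.filter (fun w => z w = c)).card : ℝ) / 2 ^ k := by
            refine Finset.sum_le_sum fun c hc => ?_
            have hcg : c ∈ Good := (Finset.mem_filter.1 hc).2
            simp only [hMdef, if_pos hcg]
            have := Nat.cast_div_le (m := (W.filter (fun w => z w = c)).card) (n := 2 ^ k) (α := ℝ)
            simpa using this
        _ ≤ ∑ c ∈ W.image z, ((W.filter (fun w => z w = c)).card : ℝ) / 2 ^ k :=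
            Finset.sum_le_sum_of_subset_of_nonneg (Finset.filter_subset _ _) fun c _ _ => by positivity
        _ = W.card / 2 ^ k := by rw [← Finset.sum_div, ← Nat.cast_sum, sum_card_filter_val]
    · rw [← hbad]
      refine le_of_eq (Finset.sum_congr rfl fun c hc => ?_)
      have hcg : c ∉ Good := (Finset.mem_filter.1 hc).2
      simp only [hMdef, if_neg hcg]
  calc (Fintype.card γ : ℝ) * (∑ c ∈ W.image z, (M c : ℝ)) / W.card
      ≤ Fintype.card γ * (W.card / 2 ^ k + ((W.filter fun w => z w ∉ Good).card : ℝ)) / W.card := by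
        refine div_le_div_of_nonneg_right (mul_le_mul_of_nonneg_left hsum (Nat.cast_nonneg _)) hWc.le
    _ = Fintype.card γ * (1 / 2 ^ k + ((W.filter fun w => z w ∉ Good).card : ℝ) / W.card) := by
        field_simp

end ConditionalUniversal

end LeftoverHash

end Literature.Computability.Cryptography
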